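import Summits.ValiantsHypothesis.ValiantsHypothesis.Theorems.BarrierLeverAnchoredDoorHitsLowerPairsConjZprime1

/-!
# Support item `AnchoredDoorHitsLowerPairs` (stmt-ValiantsHypothesis-22510), line `anchored-peeling`:
# THE EVALUATION DOOR — the ψ-free profile-1 door with ORDERED root tails is, up to a unitriangular change of columns, the
# EVALUATION MATRIX `E(U, W) = ∏_{b ∈ U} (Σ_{γ ∈ W} θ_{bγ})` of the row monomials `x^U` at the subset-sum points `p_W = Σ_{γ ∈ W} θ_{·γ}`;
# so `det E ≠ 0 ⟹ symbolicDet 1 ≠ 0`. Conjecture nodes E(cube) / GP (multilinear interpolation on subset sums) and B (the bi-evaluation door).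

Helper file (`--supports stmt-ValiantsHypothesis-22510`; cell valiant-natproofs, rung V4, 𝒟-side door (c); registered line
`Cruxes/AnchoredDoorHitsLowerPairs/Lines/anchored_peeling.lean` v28 (planner p1 g24, R41; registered stubs `stub_vertexStep`, …, `stub_conjZprime`,
`stub_ltRestNonCanonRSWP`); prover seat val-np-p1 gen 28; memo HOME/val-np-p1/g28/MEMO-evaldoor-valnp1-g28.md). Closes NO item.

WHAT.
1. `EvalDoor.ordPhi θ`: the `x`-tails of the vertex door element `D_γ = Σ_b θ_{bγ} x_b ∏_{b' ≠ b}(1 + φ_{bγb'} x_{b'})` (`doorElem`, p631161) are taken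
   ORDERED, `φ_{bγb'} = [b < b'] θ_{b'γ}`. Then (`doorFun_ordPhi`) `[x^U] D_γ = [U ≠ ∅] ∏_{b ∈ U} θ_{bγ}`, i.e. `D_γ ≡ e^{ℓ_γ} − 1` in the zeon
   algebra (`ℓ_γ = Σ_b θ_{bγ} x_b`; telescoping), and the column of `W` in the `ψ = 0` layout, `[x^U] ∏_{γ ∈ W} D_γ` (`colFun`), satisfies the
   ZETA IDENTITY `Σ_{S ⊆ W} colFun S U = ∏_{b ∈ U} Σ_{γ ∈ W} θ_{bγ}` (`sum_colFun_powerset`; zeon convolution calculus `SplitGeneral.conv` of p683103).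
2. **THEOREM `symbolicDet_one_ne_zero_of_evalDet` (THE EVALUATION DOOR).** For ANY row family `u` and any INJECTIVE column family `w` with
   LOWER range: if `det (∏_{b ∈ u i} Σ_{γ ∈ w j} θ b γ)_{i j} ≠ 0` for some `θ : Fin h → Fin h → ℂ`, then `symbolicDet 1 h r u w ≠ 0` (hence at every
   profile, `…_of_evalDet_mono`; swapped orientation `…_of_evalDet_swap`; complex hit `anchoredHit_of_evalDet`). Proof: the evaluation matrix is the
   door layout times the zeta matrix `[w j' ⊆ w j]` of the lower family (`evalMatrix_eq_doorMatrix_mul_zeta`), and `symbolicDet_one_ne_zero_of_doorDet`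
   (p645437). So a lower pair is certified at profile 1 by ONE `h × h` matrix `θ` — reading: the row monomials `{x^U : U ∈ range u}` interpolate
   uniquely on the SUBSET-SUM NODES `{Σ_{γ ∈ W} θ_{·γ} : W ∈ range w}` (multivariate Lagrange interpolation; the column space is the exponential space
   of the nodes, cf. the least-space theory of de Boor–Ron and zonotopal algebra [cite: arXiv:1104.2072, §1]).
3. CONJECTURE NODES (offered; numerics in the memo: exhaustive on all lower pairs with ≤ 5 + 5 vertices, the 20 named census pairs r ≤ 128 in the
   nested-Hall orientation, cube_n versus every tested complex n ≤ 8, 2 700 random pairs — the evaluation determinant vanished ONLY on the pair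
   (star K_{1,4}, 4-cycle ⊔ point) and its transpose, a distinct-anchor pair):
   * `Stmt.conjEvalCube` — E(cube): rows = ALL subsets of an `n`-set `D`, columns = any injective LOWER family of `2^n` faces: some `θ` has `det E ≠ 0`
     («multilinear interpolation is unisolvent on the subset-sum nodes of every down-closed family»); `Stmt.conjEvalGP` — the same for ARBITRARY
     injective column families («the 2^h points `(p_W^U)_U` are in linearly general position»), `conjEvalCube_of_GP`; arrow
     `symbolicDet_ne_zero_cube_of_conjEvalCube` (every cube-row lower pair is hit at every profile `s ≥ 1` — CubeBall, Golay, cube/tB(N,3) for all `n`).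
   * `Stmt.conjBiEval` — B, THE BI-EVALUATION DOOR: one generic matrix `α`, root weight `α_{ad}`, `x`-tails `[a < b] α_{bd}`, `y`-tails `[d < e] α_{ae}`
     (`biEvalPoint`); for every injective lower pair some `α` makes the evaluated profile-1 minor nonzero. B ⟹ U1 ⟹ the registered stub
     `stub_vertexStep` (`stub_vertexStep_of_conjBiEval`) and the item by name (`anchoredDoorHitsLowerPairs_of_conjBiEval`).

WHAT THIS IS NOT: the conjectures are NOT proved here; no pair is certified here; nothing on crux stmt-ValiantsHypothesis-14610 or on `VP` versus `VNP`.
-/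

set_option linter.dupNamespace false

namespace Summit.ValiantsHypothesis.ValiantsHypothesis.Theorems.BarrierLever.AnchoredPeeling

open Finset MvPolynomial
open Summit.ValiantsHypothesis.ValiantsHypothesis.Theorems.BarrierLever.BrickCalculus (pexpo pexpo_def)
open SplitGeneral (conv doorFun coeff_pexpo_mul_conv coeff_pexpo_doorElem coeff_pexpo_one')

noncomputable section

namespace EvalDoor

variable {h : ℕ}

/-! ## 1. Ordered tails: the door element `e^{ℓ_γ} − 1` -/

/-- **Ordered root tails:** the anchor `(b | γ)` has `x`-tail `θ_{b'γ}` at the LATER vertices `b' > b` and no tail at earlier ones. -/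
def ordPhi (θ : Fin h → Fin h → ℂ) : Fin h → Fin h → Fin h → ℂ := fun b γ b' => if b < b' then θ b' γ else 0

/-- The exponential coefficient function of the column `S`: `U ↦ ∏_{b ∈ U} (Σ_{γ ∈ S} θ_{bγ}) = [x^U] e^{ℓ_S}`, the row monomial `x^U` evaluated at the
subset-sum point `p_S = Σ_{γ ∈ S} θ_{·γ}`. -/
def expFun (θ : Fin h → Fin h → ℂ) (S : Finset (Fin h)) : Finset (Fin h) → ℂ := fun U => ∏ b ∈ U, ∑ γ ∈ S, θ b γ

/-- The column coefficient function of `S` in the `ψ = 0` door layout with ordered tails: `U ↦ [x^U] ∏_{γ ∈ S} D_γ`. -/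
def colFun (θ : Fin h → Fin h → ℂ) (S : Finset (Fin h)) : Finset (Fin h) → ℂ :=
  fun U => coeff (pexpo U ∅) (∏ γ ∈ S, doorElem θ (ordPhi θ) γ)

/-- **`[x^U] D_γ = [U ≠ ∅] · ∏_{b ∈ U} θ_{bγ}` for ordered tails** (only the root `b = min U` survives: telescoping `∏_b (1 + t_b) − 1 = Σ_b t_b ∏_{b' > b} (1 + t_{b'})`). -/
theorem doorFun_ordPhi (θ : Fin h → Fin h → ℂ) (γ : Fin h) (U : Finset (Fin h)) :
    doorFun θ (ordPhi θ) γ U = if U = ∅ then 0 else ∏ b ∈ U, θ b γ := by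
  classical
  unfold SplitGeneral.doorFun ordPhi
  by_cases hU : U = ∅
  · rw [if_pos hU, hU, Finset.sum_empty]
  · rw [if_neg hU]
    have hne : U.Nonempty := Finset.nonempty_iff_ne_empty.mpr hU
    rw [Finset.sum_eq_single (U.min' hne)]
    · have hprod : ∏ b' ∈ U.erase (U.min' hne), (if U.min' hne < b' then θ b' γ else 0) = ∏ b' ∈ U.erase (U.min' hne), θ b' γ := by
        refine Finset.prod_congr rfl (fun b' hb' => ?_)
        rw [if_pos (lt_of_le_of_ne (Finset.min'_le U b' (Finset.mem_of_mem_erase hb')) (Finset.ne_of_mem_erase hb').symm)]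
      rw [hprod, Finset.mul_prod_erase U (fun b => θ b γ) (Finset.min'_mem U hne)]
    · intro b hbU hbne
      have hmin : U.min' hne ∈ U.erase b := Finset.mem_erase.mpr ⟨fun heq => hbne heq.symm, Finset.min'_mem U hne⟩
      rw [Finset.prod_eq_zero hmin (if_neg (not_lt.mpr (Finset.min'_le U b hbU))), mul_zero]
    · intro hmin
      exact absurd (Finset.min'_mem U hne) hmin

/-- The empty column: `colFun θ ∅ = [U = ∅]`. -/
theorem colFun_empty (θ : Fin h → Fin h → ℂ) (U : Finset (Fin h)) : colFun θ ∅ U = if U = ∅ then 1 else 0 := by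
  unfold colFun
  rw [Finset.prod_empty, coeff_pexpo_one']

/-- Adding a vertex to the column convolves with its door coefficient function (zeon product rule). -/
theorem colFun_insert (θ : Fin h → Fin h → ℂ) {γ : Fin h} {S : Finset (Fin h)} (hγ : γ ∉ S) (U : Finset (Fin h)) :
    colFun θ (insert γ S) U = conv (doorFun θ (ordPhi θ) γ) (colFun θ S) U := by
  classical
  unfold colFun
  rw [Finset.prod_insert hγ, coeff_pexpo_mul_conv]
  have e1 : (fun V => coeff (pexpo V ∅) (doorElem θ (ordPhi θ) γ)) = doorFun θ (ordPhi θ) γ := funext (coeff_pexpo_doorElem θ (ordPhi θ) γ)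
  rw [e1]

/-- The empty exponential function: `expFun θ ∅ = [U = ∅]`. -/
theorem expFun_empty (θ : Fin h → Fin h → ℂ) (U : Finset (Fin h)) : expFun θ ∅ U = if U = ∅ then 1 else 0 := by
  unfold expFun
  by_cases hU : U = ∅
  · rw [if_pos hU, hU, Finset.prod_empty]
  · rw [if_neg hU]
    obtain ⟨b, hb⟩ := Finset.nonempty_iff_ne_empty.mpr hU
    exact Finset.prod_eq_zero hb (by rw [Finset.sum_empty])

/-- Convolution is additive over finite sums in the second argument. -/
theorem conv_sum_right {ι : Type*} (f : Finset (Fin h) → ℂ) (T : Finset ι) (g : ι → Finset (Fin h) → ℂ) (U : Finset (Fin h)) :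
    conv f (fun V => ∑ i ∈ T, g i V) U = ∑ i ∈ T, conv f (g i) U := by
  classical
  unfold SplitGeneral.conv
  simp_rw [Finset.mul_sum]
  rw [Finset.sum_comm]

/-- Convolution is compatible with differences in the first argument. -/
theorem conv_sub_left (f₁ f₂ g : Finset (Fin h) → ℂ) (U : Finset (Fin h)) :
    conv (fun V => f₁ V - f₂ V) g U = conv f₁ g U - conv f₂ g U := by
  classical
  unfold SplitGeneral.conv
  simp_rw [sub_mul]
  rw [Finset.sum_sub_distrib]

/-- The door coefficient function with ordered tails is `e^{ℓ_γ} − 1`: `expFun θ {γ} − δ_∅`. -/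
theorem doorFun_ordPhi_eq (θ : Fin h → Fin h → ℂ) (γ : Fin h) :
    doorFun θ (ordPhi θ) γ = fun U => expFun θ {γ} U - SplitGeneral.dlt ∅ U := by
  funext U
  rw [doorFun_ordPhi, expFun, SplitGeneral.dlt]
  simp_rw [Finset.sum_singleton]
  by_cases hU : U = ∅
  · rw [if_pos hU, if_pos hU, hU, Finset.prod_empty, sub_self]
  · rw [if_neg hU, if_neg hU, sub_zero]

/-- `e^{ℓ_γ} ⋆ e^{ℓ_W} = e^{ℓ_{W+γ}}` for `γ ∉ W` (coefficient functions; `Finset.prod_add`). -/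
theorem conv_expFun_singleton (θ : Fin h → Fin h → ℂ) {γ : Fin h} {W : Finset (Fin h)} (hγ : γ ∉ W) (U : Finset (Fin h)) :
    conv (expFun θ {γ}) (expFun θ W) U = expFun θ (insert γ W) U := by
  classical
  unfold SplitGeneral.conv expFun
  simp_rw [Finset.sum_singleton]
  rw [Finset.prod_congr rfl (fun b (_ : b ∈ U) => Finset.sum_insert hγ (f := fun γ' => θ b γ')), Finset.prod_add]

/-- `δ_∅ ⋆ g = g`. -/
theorem conv_dlt_empty_left (g : Finset (Fin h) → ℂ) (U : Finset (Fin h)) : conv (SplitGeneral.dlt ∅) g U = g U := by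
  classical
  rw [SplitGeneral.conv_dlt_left, if_pos (Finset.empty_subset U), Finset.sdiff_empty]

/-- **The key convolution:** `(e^{ℓ_γ} − 1) ⋆ e^{ℓ_W} = e^{ℓ_{W+γ}} − e^{ℓ_W}` at the level of coefficient functions. -/
theorem conv_doorFun_expFun (θ : Fin h → Fin h → ℂ) {γ : Fin h} {W : Finset (Fin h)} (hγ : γ ∉ W) (U : Finset (Fin h)) :
    conv (doorFun θ (ordPhi θ) γ) (expFun θ W) U + expFun θ W U = expFun θ (insert γ W) U := by
  rw [doorFun_ordPhi_eq, conv_sub_left, conv_expFun_singleton θ hγ, conv_dlt_empty_left, sub_add_cancel]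

/-- **THE ZETA IDENTITY:** `Σ_{S ⊆ W} [x^U] ∏_{γ ∈ S} D_γ = ∏_{b ∈ U} Σ_{γ ∈ W} θ_{bγ}` — the ordered-tail door columns are the Möbius transforms of the
evaluation columns. -/
theorem sum_colFun_powerset (θ : Fin h → Fin h → ℂ) (W : Finset (Fin h)) : ∀ U : Finset (Fin h), ∑ S ∈ W.powerset, colFun θ S U = expFun θ W U := by
  classical
  induction W using Finset.induction_on with
  | empty =>
    intro U
    rw [Finset.powerset_empty, Finset.sum_singleton, colFun_empty, expFun_empty]
  | @insert γ W hγ ih =>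
    intro U
    rw [Finset.sum_powerset_insert hγ, ih U]
    have hins : ∀ S ∈ W.powerset, colFun θ (insert γ S) U = conv (doorFun θ (ordPhi θ) γ) (colFun θ S) U :=
      fun S hS => colFun_insert θ (fun hγS => hγ (Finset.mem_powerset.mp hS hγS)) U
    rw [Finset.sum_congr rfl hins, ← conv_sum_right]
    have hfun : (fun V => ∑ S ∈ W.powerset, colFun θ S V) = expFun θ W := funext ih
    rw [hfun, add_comm, conv_doorFun_expFun θ hγ U]

/-! ## 2. THE EVALUATION DOOR -/

/-- **The evaluation matrix factors: `E = (door layout) · (zeta of the lower column family)`.** -/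
theorem evalMatrix_eq_doorMatrix_mul_zeta (θ : Fin h → Fin h → ℂ) {r : ℕ} (u w : Fin r → Finset (Fin h)) (hw : Function.Injective w)
    (hlw : IsLowerSet (Set.range w)) :
    (Matrix.of fun i j : Fin r => ∏ b ∈ u i, ∑ γ ∈ w j, θ b γ) =
      (Matrix.of fun i j : Fin r => coeff (pexpo (u i) ∅) (∏ γ ∈ w j, doorElem θ (ordPhi θ) γ)) *
        (Matrix.of fun j' j : Fin r => if w j' ⊆ w j then (1 : ℂ) else 0) := by
  classical
  ext i j
  rw [Matrix.mul_apply, Matrix.of_apply]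
  simp only [Matrix.of_apply, mul_ite, mul_one, mul_zero]
  rw [← Finset.sum_filter]
  have himg : (Finset.univ.filter (fun j' : Fin r => w j' ⊆ w j)).image w = (w j).powerset := by
    ext S
    simp only [Finset.mem_image, Finset.mem_filter, Finset.mem_univ, true_and, Finset.mem_powerset]
    constructor
    · rintro ⟨j', hj', rfl⟩
      exact hj'
    · intro hS
      obtain ⟨j', hj'⟩ : S ∈ Set.range w := hlw (show S ≤ w j from hS) ⟨j, rfl⟩
      exact ⟨j', by rw [hj']; exact hS, hj'⟩
  have hsum : ∑ j' ∈ Finset.univ.filter (fun j' : Fin r => w j' ⊆ w j), coeff (pexpo (u i) ∅) (∏ γ ∈ w j', doorElem θ (ordPhi θ) γ) =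
      ∑ S ∈ (Finset.univ.filter (fun j' : Fin r => w j' ⊆ w j)).image w, colFun θ S (u i) := by
    rw [Finset.sum_image (fun j₁ _ j₂ _ hj => hw hj)]
    rfl
  rw [hsum, himg, sum_colFun_powerset θ (w j) (u i)]
  rfl

/-- **THE EVALUATION DOOR.** For any row family `u` and any injective column family `w` with lower range: a nonsingular EVALUATION MATRIX
`(∏_{b ∈ u i} Σ_{γ ∈ w j} θ_{bγ})_{i j}` — the row monomials `x^{u i}` evaluated at the subset-sum points `p_{w j} = Σ_{γ ∈ w j} θ_{·γ}` — certifies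
`symbolicDet 1 h r u w ≠ 0` (the `ψ = 0` member of 𝔄₁ with root weights `θ` and ORDERED tails has this layout determinant up to the unitriangular zeta
factor of the lower family). -/
theorem symbolicDet_one_ne_zero_of_evalDet {r : ℕ} (u w : Fin r → Finset (Fin h)) (hw : Function.Injective w) (hlw : IsLowerSet (Set.range w))
    (θ : Fin h → Fin h → ℂ) (hdet : (Matrix.of fun i j : Fin r => ∏ b ∈ u i, ∑ γ ∈ w j, θ b γ).det ≠ 0) :
    symbolicDet 1 h r u w ≠ 0 := by
  apply symbolicDet_one_ne_zero_of_doorDet u w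
  refine ⟨θ, ordPhi θ, fun hC => hdet ?_⟩
  rw [evalMatrix_eq_doorMatrix_mul_zeta θ u w hw hlw, Matrix.det_mul, hC, zero_mul]

/-- **The evaluation door at every profile `s ≥ 1`** (`symbolicDet_ne_zero_mono`). -/
theorem symbolicDet_ne_zero_of_evalDet {s r : ℕ} (hs : 1 ≤ s) (u w : Fin r → Finset (Fin h)) (hw : Function.Injective w)
    (hlw : IsLowerSet (Set.range w)) (θ : Fin h → Fin h → ℂ)
    (hdet : (Matrix.of fun i j : Fin r => ∏ b ∈ u i, ∑ γ ∈ w j, θ b γ).det ≠ 0) : symbolicDet s h r u w ≠ 0 :=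
  symbolicDet_ne_zero_mono hs (symbolicDet_one_ne_zero_of_evalDet u w hw hlw θ hdet)

/-- **The evaluation door in the SWAPPED orientation:** column monomials `y^{w j}` evaluated at the subset-sum points of the (injective, lower) ROW
family certify the pair as well (`symbolicDet_ne_zero_swap`). -/
theorem symbolicDet_ne_zero_of_evalDet_swap {s r : ℕ} (hs : 1 ≤ s) (u w : Fin r → Finset (Fin h)) (hu : Function.Injective u)
    (hlu : IsLowerSet (Set.range u)) (θ : Fin h → Fin h → ℂ)
    (hdet : (Matrix.of fun i j : Fin r => ∏ d ∈ w i, ∑ a ∈ u j, θ d a).det ≠ 0) : symbolicDet s h r u w ≠ 0 :=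
  symbolicDet_ne_zero_swap s h r u w (symbolicDet_ne_zero_of_evalDet hs w u hu hlu θ hdet)

/-- **Complex form:** a nonsingular evaluation matrix gives a member of the anchored door 𝔄_s with nonzero partition minor (`stub_genericPoint`). -/
theorem anchoredHit_of_evalDet {s r : ℕ} (hs : 1 ≤ s) (u w : Fin r → Finset (Fin h)) (hw : Function.Injective w)
    (hlw : IsLowerSet (Set.range w)) (θ : Fin h → Fin h → ℂ)
    (hdet : (Matrix.of fun i j : Fin r => ∏ b ∈ u i, ∑ γ ∈ w j, θ b γ).det ≠ 0) : AnchoredHit s h r u w :=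
  stub_genericPoint s h r u w (symbolicDet_ne_zero_of_evalDet hs u w hw hlw θ hdet)

end EvalDoor

/-! ## 3. Conjecture nodes: E(cube) / GP and B (offered texts; arrows by name) -/

/-- **CONJECTURE E(cube) — MULTILINEAR INTERPOLATION ON THE SUBSET SUMS OF A DOWN-CLOSED FAMILY (offered node text).** For all `h`, every
`D ⊆ Fin h` and every injective `u` enumerating EXACTLY the subsets of `D` (the cube / full simplex on `D` as the row complex), and every injective
`w` with LOWER range and the same number `2^{|D|}` of faces, some complex `θ : Fin h → Fin h → ℂ` makes the evaluation matrix
`(∏_{b ∈ u i} Σ_{γ ∈ w j} θ_{bγ})_{i j}` nonsingular. (Nested Hall is automatic here by Kruskal–Katona. WHY IT MIGHT FAIL: a down-closed family of `2^n`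
sets whose subset-sum nodes lie on a multilinear hypersurface for every choice of the generating vectors — none among all such families on `≤ 5`
column vertices, cube_n versus `K_N + T` and random 2-complexes to `n = 8`, and the named census pairs.) By `EvalDoor.symbolicDet_ne_zero_of_evalDet`
it gives every cube-row lower pair at every profile (`symbolicDet_ne_zero_cube_of_conjEvalCube`): CubeBall, Golay, cube_n versus tB(N,3) for all `n`. -/
def Stmt.conjEvalCube : Prop :=
  ∀ (h r : ℕ) (D : Finset (Fin h)) (u w : Fin r → Finset (Fin h)), Function.Injective u → Function.Injective w →
    Set.range u = {S | S ⊆ D} → IsLowerSet (Set.range w) →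
    ∃ θ : Fin h → Fin h → ℂ, (Matrix.of fun i j : Fin r => ∏ b ∈ u i, ∑ γ ∈ w j, θ b γ).det ≠ 0

/-- **CONJECTURE GP — GENERAL POSITION OF THE MULTILINEAR VERONESE OF SUBSET SUMS (offered, stronger):** the same for ARBITRARY injective column
families `w` (no lower-set hypothesis): for generic `θ` the `2^h` points `((Σ_{γ ∈ W} θ_{bγ})_{b})^U`, `W ⊆ Fin h`, indexed over `U ⊆ D`, are in
linearly general position. (Numerics: random, uniform-layer, top-layer and interval families, `n ≤ 4`, `N ≤ 7`: no singular case.) -/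
def Stmt.conjEvalGP : Prop :=
  ∀ (h r : ℕ) (D : Finset (Fin h)) (u w : Fin r → Finset (Fin h)), Function.Injective u → Function.Injective w →
    Set.range u = {S | S ⊆ D} →
    ∃ θ : Fin h → Fin h → ℂ, (Matrix.of fun i j : Fin r => ∏ b ∈ u i, ∑ γ ∈ w j, θ b γ).det ≠ 0

/-- GP ⟹ E(cube). -/
theorem conjEvalCube_of_GP (hG : Stmt.conjEvalGP) : Stmt.conjEvalCube :=
  fun h r D u w hu hw hru _ => hG h r D u w hu hw hru

/-- **E(cube) ⟹ every cube-row lower pair is hit at every profile `s ≥ 1`.** -/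
theorem symbolicDet_ne_zero_cube_of_conjEvalCube (hE : Stmt.conjEvalCube) {s h r : ℕ} (hs : 1 ≤ s) (D : Finset (Fin h))
    (u w : Fin r → Finset (Fin h)) (hu : Function.Injective u) (hw : Function.Injective w) (hru : Set.range u = {S | S ⊆ D})
    (hlw : IsLowerSet (Set.range w)) : symbolicDet s h r u w ≠ 0 := by
  obtain ⟨θ, hdet⟩ := hE h r D u w hu hw hru hlw
  exact EvalDoor.symbolicDet_ne_zero_of_evalDet hs u w hw hlw θ hdet

variable {h : ℕ}

/-- **The bi-evaluation point of 𝔄₁ for the matrix `α`:** the vertex anchor `(a | d)` has weight `α_{ad}`, `x`-tail `α_{bd}` at the later row vertices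
`b > a`, `y`-tail `α_{ae}` at the later column vertices `e > d` (values on other anchors: the same sums; irrelevant at profile 1). -/
def biEvalPoint (α : Fin h → Fin h → ℂ) : Param h → ℂ
  | Sum.inl β => ∑ a ∈ β.1, ∑ d ∈ β.2, α a d
  | Sum.inr (Sum.inl (β, b)) => ∑ a ∈ β.1, ∑ d ∈ β.2, if a < b then α b d else 0
  | Sum.inr (Sum.inr (β, e)) => ∑ a ∈ β.1, ∑ d ∈ β.2, if d < e then α a e else 0

/-- **CONJECTURE B — THE BI-EVALUATION DOOR (offered node text; a one-matrix form of U1).** For all `h`, `r` and every pair of injective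
enumerations `u`, `w` of lower families, SOME complex `h × h` matrix `α` makes the profile-1 symbolic minor NONZERO AT THE BI-EVALUATION POINT
`biEvalPoint α` (root weight `α_{ad}`, `x`-tails `[a < b] α_{bd}`, `y`-tails `[d < e] α_{ae}`). WHY IT MIGHT FAIL: a lower pair on which this
`h²`-parameter member of 𝔄₁ is identically singular (none among ALL lower pairs on `≤ 5 + 5` vertices in every orientation — 2 112 pairs up to
isomorphism, including the doubly nested-Hall-failing ones and the pair (K_{1,4}, C₄ ⊔ point) on which every `ψ`-free door dies —, the 20 named census
pairs `r ≤ 128` in both orientations, and 1 100 random lower pairs `r ≤ 140`). -/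
def Stmt.conjBiEval : Prop :=
  ∀ (h r : ℕ) (u w : Fin r → Finset (Fin h)), Function.Injective u → Function.Injective w →
    IsLowerSet (Set.range u) → IsLowerSet (Set.range w) →
    ∃ α : Fin h → Fin h → ℂ, MvPolynomial.eval (biEvalPoint α) (symbolicDet 1 h r u w) ≠ 0

/-- **B ⟹ U1:** every injective lower pair is hit at profile 1 (and at every `s ≥ 1`). -/
theorem symbolicDet_ne_zero_of_conjBiEval (hB : Stmt.conjBiEval) {s h r : ℕ} (hs : 1 ≤ s) (u w : Fin r → Finset (Fin h))
    (hu : Function.Injective u) (hw : Function.Injective w) (hlu : IsLowerSet (Set.range u)) (hlw : IsLowerSet (Set.range w)) :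
    symbolicDet s h r u w ≠ 0 := by
  obtain ⟨α, hα⟩ := hB h r u w hu hw hlu hlw
  refine symbolicDet_ne_zero_mono hs (fun h0 => hα ?_)
  rw [h0, map_zero]

/-- **B ⟹ THE REGISTERED STUB `stub_vertexStep`** (outright). -/
theorem stub_vertexStep_of_conjBiEval (hB : Stmt.conjBiEval) : Stmt.stub_vertexStep := by
  intro h r u w hu hw hlu hlw _ _ _
  exact symbolicDet_ne_zero_of_conjBiEval hB (le_refl 1) u w hu hw hlu hlw

/-- **B ⟹ the v26 residual `Stmt.stub_ltRestNonCanonRSW` OUTRIGHT** (at `s = 1`, `h₀ = 0`). -/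
theorem stub_ltRestNonCanonRSW_of_conjBiEval (hB : Stmt.conjBiEval) : Stmt.stub_ltRestNonCanonRSW := by
  refine ⟨1, 0, le_refl 1, ?_⟩
  intro h _ r u w hu hw hlu hlw _ _ _ _ _ _ _ _ _ _ _ _ _
  exact symbolicDet_ne_zero_of_conjBiEval hB (le_refl 1) u w hu hw hlu hlw

/-- **Composition BY NAME: `Stmt.conjBiEval → AnchoredDoorHitsLowerPairs`.** -/
theorem anchoredDoorHitsLowerPairs_of_conjBiEval (hB : Stmt.conjBiEval) :
    Summit.ValiantsHypothesis.ValiantsHypothesis.Theses.BarrierLever.AnchoredDoorHitsLowerPairs :=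
  anchoredDoorHitsLowerPairs_of_ltRestNonCanonRSW (stub_ltRestNonCanonRSW_of_conjBiEval hB)

end

end Summit.ValiantsHypothesis.ValiantsHypothesis.Theorems.BarrierLever.AnchoredPeeling
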